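import Mathlib
import Literature.MathematicalPhysics.StatisticalMechanics.Crystallization

/-!
# Crux `ExactCertificate` (stmt-AtomisticToContinuum-11959), line `closure-makes-nogap-exact`,
# Transfer skeleton VI (`UniquePeriodicMinimiser1D`): stub `stub_exactOfGood1D`

Support file for the crux `ThreeConeCertificate.ExactCertificate`, d = 1 transfer skeleton VI
(`Cruxes.ExactCertificate.Transfer1D.UniquePeriodicMinimiser1D`).  This file proves the registered
stub `stub_exactOfGood1D`: MATCHING AT EVERY SCALE AND TOLERANCE IS EXACT CONGRUENCE on the line.
If a site `q` of a periodic configuration `Q` of `ℝ¹` is two-way `(R, ε)`-matched to the periodic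
template `P` for ALL `R, ε > 0` — for every `R, ε > 0` some linear isometry `A` has every template
point `p`, `‖p‖ ≤ R`, within `ε` of `Q.points` after the motion `p ↦ q + A p`, and every point of `Q`
within `R` of `q` within `ε` of `q + A(P.points)` — then `Q.points = q + A(P.points)` EXACTLY for one
linear isometry `A` (the d = 1 twin of `…SlackRigidityLawCongruence.eq_image_of_forall_locallyMatches`).

Proof.  Choose `A n` matching at `(n + 1, 1 / (n + 1))`.  The linear isometries of `ℝ¹` form a compact
set (closed unit ball of the finite-dimensional space `ℝ¹ →L[ℝ] ℝ¹`), so a subsequence `A (φ j)`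
converges pointwise to a linear isometry `B` (`ucong_exists_tendsto_linearIsometry`).
* `Q.points ⊆ q + B(P.points)`: for `z ∈ Q.points` the template points `p` with
  `dist z (q + A (φ j) p) ≤ 1/(φ j + 1)` lie in the FINITE set `B̄(0, dist z q + 1) ∩ P.points`
  (local finiteness of a periodic configuration, `PeriodicConfiguration.finite_inter_points`); if
  none of them had `q + B p = z`, then for large `j` every such `p` would satisfy
  `1/(φ j + 1) < dist z (q + A (φ j) p)`, contradicting the matching.
* `q + B(P.points) ⊆ Q.points`: for `p ∈ P.points` the matching gives points of `Q` within
  `1/(φ j + 1)` of `q + A (φ j) p → q + B p`, and `Q.points` is closed (a locally finite set is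
  closed, `ucong_isClosed_points`).
All `[folklore]`; no named facts are used.  Helper lemmas are prefixed `ucong_`.
-/

noncomputable section

namespace Summit.AtomisticToContinuum.Crystallization.Theorems.ThreeConeCertificateExactCertificate.Transfer1D

open Literature.MathematicalPhysics.StatisticalMechanics MeasureTheory Set Filter Topology
open scoped BigOperators

/-- **Sequential compactness of the linear isometries of `ℝ¹`** (pointwise form): every sequence of
linear isometries `A n : ℝ¹ →ₗᵢ ℝ¹` has a subsequence converging pointwise to a linear isometry.
(The associated continuous linear maps lie in the closed unit ball of the finite-dimensional, hence
proper, space `ℝ¹ →L[ℝ] ℝ¹`; a limit of norm-preserving maps preserves norms.) [folklore] -/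
theorem ucong_exists_tendsto_linearIsometry
    (A : ℕ → EuclideanSpace ℝ (Fin 1) →ₗᵢ[ℝ] EuclideanSpace ℝ (Fin 1)) :
    ∃ (B : EuclideanSpace ℝ (Fin 1) →ₗᵢ[ℝ] EuclideanSpace ℝ (Fin 1)) (φ : ℕ → ℕ), StrictMono φ ∧
      ∀ p : EuclideanSpace ℝ (Fin 1), Tendsto (fun j => A (φ j) p) atTop (𝓝 (B p)) := by
  -- adapted from `SlackRigidityLawCongruence.exists_tendsto_linearIsometry` (d = 3)
  have hmem : ∀ n, (A n).toContinuousLinearMap ∈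
      Metric.closedBall (0 : EuclideanSpace ℝ (Fin 1) →L[ℝ] EuclideanSpace ℝ (Fin 1)) 1 :=
    fun n => mem_closedBall_zero_iff.2 (A n).norm_toContinuousLinearMap_le
  obtain ⟨T, -, φ, hφ, hlim⟩ :=
    (isCompact_closedBall (0 : EuclideanSpace ℝ (Fin 1) →L[ℝ] EuclideanSpace ℝ (Fin 1)) 1).tendsto_subseq
      hmem
  have hpt : ∀ p : EuclideanSpace ℝ (Fin 1), Tendsto (fun j => A (φ j) p) atTop (𝓝 (T p)) :=
    fun p => by
    have h := ((continuous_eval_const p).tendsto T).comp hlim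
    simpa [Function.comp_def] using h
  have hT : ∀ x : EuclideanSpace ℝ (Fin 1), ‖T x‖ = ‖x‖ := fun x => by
    refine tendsto_nhds_unique (hpt x).norm ?_
    simp only [LinearIsometry.norm_map]
    exact tendsto_const_nhds
  exact ⟨⟨(T : EuclideanSpace ℝ (Fin 1) →ₗ[ℝ] EuclideanSpace ℝ (Fin 1)), hT⟩, φ, hφ, hpt⟩

/-- **A periodic configuration has a closed point set**: it is locally finite (finitely many points
in every bounded set), and a point of the closure lies in the closure of the finitely many points
in the unit ball around it. [folklore] -/
theorem ucong_isClosed_points {d : ℕ} (P : PeriodicConfiguration d) : IsClosed P.points := by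
  refine isClosed_of_closure_subset fun x hx => ?_
  have hfin : (Metric.ball x 1 ∩ P.points).Finite := P.finite_inter_points Metric.isBounded_ball
  have h : x ∈ closure (Metric.ball x 1 ∩ P.points) :=
    Metric.isOpen_ball.inter_closure ⟨Metric.mem_ball_self one_pos, hx⟩
  rw [hfin.isClosed.closure_eq] at h
  exact h.2

/-- **From matching at every scale to congruence** (stub W3 of Transfer skeleton VI): if a site `q`
of the periodic configuration `Q` of the line is two-way `(R, ε)`-matched to the periodic template
`P` for ALL `R, ε > 0`, then `Q.points = q + A(P.points)` EXACTLY for one linear isometry `A` of the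
line (compactness of the linear isometries, local finiteness of `P.points`, closedness of
`Q.points`). [folklore] -/
theorem stub_exactOfGood1D : ∀ (P Q : PeriodicConfiguration 1) (q : EuclideanSpace ℝ (Fin 1)), q ∈ Q.points →
    (∀ R ε : ℝ, 0 < R → 0 < ε → ∃ A : EuclideanSpace ℝ (Fin 1) →ₗᵢ[ℝ] EuclideanSpace ℝ (Fin 1),
        (∀ p ∈ P.points, ‖p‖ ≤ R → ∃ z ∈ Q.points, dist z (q + A p) ≤ ε) ∧
        (∀ z ∈ Q.points, dist z q ≤ R → ∃ p ∈ P.points, dist z (q + A p) ≤ ε)) →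
    ∃ A : EuclideanSpace ℝ (Fin 1) →ₗᵢ[ℝ] EuclideanSpace ℝ (Fin 1), Q.points = (fun p => q + A p) '' P.points := by
  intro P Q q _ hmatch
  choose A hA using fun n : ℕ =>
    hmatch ((n : ℝ) + 1) (1 / ((n : ℝ) + 1)) (Nat.cast_add_one_pos n) Nat.one_div_pos_of_nat
  obtain ⟨B, φ, hφ, hpt⟩ := ucong_exists_tendsto_linearIsometry A
  have hR : Tendsto (fun j => (φ j : ℝ) + 1) atTop atTop :=
    tendsto_atTop_add_const_right _ 1
      ((tendsto_natCast_atTop_atTop (R := ℝ)).comp hφ.tendsto_atTop)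
  have hε : Tendsto (fun j => 1 / ((φ j : ℝ) + 1)) atTop (𝓝 0) :=
    (tendsto_one_div_add_atTop_nhds_zero_nat (𝕜 := ℝ)).comp hφ.tendsto_atTop
  have hqpt : ∀ p : EuclideanSpace ℝ (Fin 1),
      Tendsto (fun j => q + A (φ j) p) atTop (𝓝 (q + B p)) := fun p =>
    tendsto_const_nhds.add (hpt p)
  refine ⟨B, Subset.antisymm (fun z hz => ?_) ?_⟩
  · -- `Q.points ⊆ q + B(P.points)`: pigeonhole on the finitely many template points near `z - q`
    have hfin : (Metric.closedBall (0 : EuclideanSpace ℝ (Fin 1)) (dist z q + 1) ∩ P.points).Finite :=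
      P.finite_inter_points Metric.isBounded_closedBall
    by_contra hzB
    have hpos : ∀ p ∈ Metric.closedBall (0 : EuclideanSpace ℝ (Fin 1)) (dist z q + 1) ∩ P.points,
        0 < dist z (q + B p) := by
      rintro p ⟨-, hp⟩
      exact dist_pos.2 fun h => hzB ⟨p, hp, h.symm⟩
    have hev : ∀ᶠ j in atTop,
        ∀ p ∈ Metric.closedBall (0 : EuclideanSpace ℝ (Fin 1)) (dist z q + 1) ∩ P.points,
          1 / ((φ j : ℝ) + 1) < dist z (q + A (φ j) p) := by
      refine hfin.eventually_all.2 fun p hp => ?_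
      have h1 := ((tendsto_const_nhds (x := z)).dist (hqpt p)).eventually_const_lt
        (half_lt_self (hpos p hp))
      have h2 := hε.eventually_lt_const (half_pos (hpos p hp))
      exact (h1.and h2).mono fun j hj => hj.2.trans hj.1
    obtain ⟨j, hj, hjq⟩ := (hev.and (hR.eventually_ge_atTop (dist z q))).exists
    obtain ⟨p, hp, hd⟩ := (hA (φ j)).2 z hz hjq
    have hle : 1 / ((φ j : ℝ) + 1) ≤ 1 := by
      rw [div_le_one (Nat.cast_add_one_pos _)]
      exact le_add_of_nonneg_left (Nat.cast_nonneg _)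
    have hpB : p ∈ Metric.closedBall (0 : EuclideanSpace ℝ (Fin 1)) (dist z q + 1) ∩ P.points := by
      refine ⟨mem_closedBall_zero_iff.2 ?_, hp⟩
      calc ‖p‖ = ‖A (φ j) p‖ := ((A (φ j)).norm_map p).symm
        _ = dist (q + A (φ j) p) q := by rw [dist_eq_norm, add_sub_cancel_left]
        _ ≤ dist (q + A (φ j) p) z + dist z q := dist_triangle _ _ _
        _ = dist z (q + A (φ j) p) + dist z q := by rw [dist_comm (q + A (φ j) p) z]
        _ ≤ 1 + dist z q := add_le_add (hd.trans hle) le_rfl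
        _ = dist z q + 1 := add_comm _ _
    exact (hj p hpB).not_ge hd
  · -- `q + B(P.points) ⊆ Q.points`: `Q.points` is closed and `q + A (φ j) p → q + B p` is
    -- approached by points of `Q`
    rintro _ ⟨p, hp, rfl⟩
    rw [Metric.mem_of_closed' (ucong_isClosed_points Q)]
    intro η hη
    have h1 : ∀ᶠ j in atTop, dist (q + A (φ j) p) (q + B p) < η / 2 :=
      Metric.tendsto_nhds.1 (hqpt p) _ (half_pos hη)
    have h2 := hε.eventually_lt_const (half_pos hη)
    obtain ⟨j, ⟨hj1, hj2⟩, hjp⟩ := ((h1.and h2).and (hR.eventually_ge_atTop ‖p‖)).exists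
    obtain ⟨z, hz, hd⟩ := (hA (φ j)).1 p hp hjp
    refine ⟨z, hz, ?_⟩
    calc dist (q + B p) z ≤ dist (q + B p) (q + A (φ j) p) + dist (q + A (φ j) p) z :=
          dist_triangle _ _ _
      _ < η / 2 + η / 2 := by
          rw [dist_comm (q + B p) (q + A (φ j) p), dist_comm (q + A (φ j) p) z]
          exact add_lt_add hj1 (hd.trans_lt hj2)
      _ = η := add_halves η

end Summit.AtomisticToContinuum.Crystallization.Theorems.ThreeConeCertificateExactCertificate.Transfer1D

end
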